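import Mathlib
import HarnessLib
import Summits.CriticalPhenomena.Ising3DConformalLimit.Theorems.HyperoctahedralRPTwoPointKernelOfLimitClauses
import Summits.CriticalPhenomena.Ising3DConformalLimit.Theorems.HarmonicMomentsIsotropyTwoPointAsymptoticIsotropyLatticeIntegral
import Summits.CriticalPhenomena.Ising3DConformalLimit.Theorems.HarmonicMomentsIsotropyTwoPointAsymptoticIsotropyBulk
import Summits.CriticalPhenomena.Ising3DConformalLimit.Theorems.HarmonicMomentsIsotropyTwoPointAsymptoticIsotropyShells
import Summits.CriticalPhenomena.Ising3DConformalLimit.Theorems.HarmonicMomentsIsotropyTwoPointAsymptoticIsotropyDecay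
import Literature.Probability.LatticeModels.HighDimPointwiseTriviality
import Literature.Probability.LatticeModels.CriticalScalingDimension

/-!
# Vague asymptotic isotropy of the critical `ℤ³` two-point function, VII:
# the bulk machinery from PAIR data only
(route HarmonicMomentsIsotropy, support item stmt-CriticalPhenomena-6036 `TwoPointAsymptoticIsotropy`;
helper file of the second conditional line `IsingEuclidUpgradeR2RotInvPowerLaw → TwoPointAsymptoticIsotropy`,
item stmt-CriticalPhenomena-0634 ⇒ item stmt-CriticalPhenomena-6036)

Files II–IV and VI of the first conditional line (`ExistsScaleCovariantLimit → TwoPointAsymptoticIsotropy`,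
`…Bulk`, `…Shells`, `…Decay`, `…AsymptoticIsotropy`) take the full pointwise scaling limit
`HasPointwiseScalingLimit (criticalCorr 3) ρ S` (all arities) as hypothesis, but their proofs only ever
use its arity-`2` clause. This file records the same statements under the ARITY-2 HYPOTHESIS ALONE,

  `hlim2 : TendstoLocallyUniformlyOn (rescaledCorrelator (criticalCorr 3) ρ 2) (S 2) (𝓝[>] 0)
            (NonCoincident 3 2)`,

i.e. locally uniform convergence of the renormalised critical PAIR correlator `ρ(δ)²⟨σ_{[a/δ]}σ_{[b/δ]}⟩_{β_c}`
to `S 2 (a, b)` off the diagonal (the proofs are those of files II–IV/VI with `hlim 2` replaced by `hlim2`):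

* `tendsto_rescaled_twoPoint₂`, `exists_eventually_rescaled_two_le₂`,
  `exists_eventually_rescaled_twoPoint_le₂` — pointwise convergence to the kernel `K(y) = S₂(0,y)` off
  the origin and uniform boundedness on compact shells;
* `tendsto_scaled_latticeSum₂` — bulk convergence `δ³ρ(δ)² Σ_x Ψ(δx)⟨σ₀σ_x⟩_{β_c} → ∫ Ψ K` for bounded,
  a.e.-continuous `Ψ` vanishing near `0` and near `∞` (Riemann sums + dominated convergence);
* `tendsto_shellSum₂`, `eventually_shellSum_ratio₂`, `exists_ratio_scale₂` — the dyadic shell sums and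
  the shell ratio `≤ 2/3` beyond a scale `L₀` (kernel homogeneous of degree `-2Δ`, `Δ ≤ 1`);
* `tendsto_cube_mul_rho_sq₂` — `δ³ρ(δ)² → 0` (Simon–Lieb lower bound `⟨σ₀σ_x⟩_{β_c} ≥ c‖x‖⁻²`).

This is what makes the pure power law of item 0634 (which controls the pair correlator only) sufficient
for the milestone (file VIII, `…OfPowerLaw`). References: G. B. Folland, *Real Analysis* (1999), Thm. 2.24;
H. Duminil-Copin, *Lectures on the Ising and Potts models* (2019), Thm. 4.8; H. Duminil-Copin, ICM 2022,
§8.1. No definitions are introduced.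
-/

noncomputable section

namespace Summit.CriticalPhenomena.Ising3DConformalLimit.HarmonicMomentsIsotropyTwoPoint

open Literature.Probability.LatticeModels MeasureTheory Filter Set Metric
open scoped Topology
open Summit.CriticalPhenomena.Ising3DConformalLimit.HyperoctahedralRPTwoPoint

/-- The indicator of the spherical shell `{a < ‖y‖ ≤ b}`. -/
local notation3 (prettyPrint := false) "shell[" a "," b "]" =>
  Set.indicator {y : EuclideanSpace ℝ (Fin 3) | a < ‖y‖ ∧ ‖y‖ ≤ b} (fun _ => (1:ℝ))

variable {ρ : ℝ → ℝ} {Δ : ℝ} {S : CorrFamily 3}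

/-! ### Pointwise convergence and uniform bounds from the pair limit -/

/-- Pointwise convergence of the rescaled two-point function to the kernel `K(y) = S₂(0, y)` off the
origin, from the arity-`2` limit alone. [folklore] -/
theorem tendsto_rescaled_twoPoint₂
    (hlim2 : TendstoLocallyUniformlyOn (rescaledCorrelator (criticalCorr 3) ρ 2) (S 2) (𝓝[>] (0:ℝ))
      (NonCoincident 3 2))
    {y : EuclideanSpace ℝ (Fin 3)} (hy : y ≠ 0) :
    Tendsto (fun δ : ℝ => ρ δ ^ 2 * criticalTwoPoint 3 (latticeApprox δ y)) (𝓝[>] (0:ℝ))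
      (𝓝 (S 2 ![0, y])) := by
  have h := hlim2.tendsto_at (zero_pair_mem_nonCoincident hy)
  simp_rw [rescaledCorrelator_zero_pair] at h
  exact h

/-- Uniform boundedness of the rescaled pair correlators on a compact set of non-coincident pairs,
for all small `δ > 0`, from the arity-`2` limit alone (uniform convergence on compacts and
`|⟨σσ⟩| ≤ 1`; the proof of `exists_eventually_rescaled_two_le` verbatim). [folklore] -/
theorem exists_eventually_rescaled_two_le₂
    (hlim2 : TendstoLocallyUniformlyOn (rescaledCorrelator (criticalCorr 3) ρ 2) (S 2) (𝓝[>] (0:ℝ))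
      (NonCoincident 3 2))
    {K : Set (Fin 2 → EuclideanSpace ℝ (Fin 3))} (hK : IsCompact K) (hKs : K ⊆ NonCoincident 3 2) :
    ∃ M : ℝ, ∀ᶠ δ in 𝓝[>] (0 : ℝ), ∀ z ∈ K,
      ρ δ ^ 2 * criticalCorr 3 2 (fun k => latticeApprox δ (z k)) ≤ M := by
  have hU : TendstoUniformlyOn (rescaledCorrelator (criticalCorr 3) ρ 2) (S 2) (𝓝[>] 0) K :=
    (tendstoLocallyUniformlyOn_iff_forall_isCompact (isOpen_nonCoincident 3 2)).1 hlim2 K hKs hK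
  have h1 : ∀ᶠ δ in 𝓝[>] (0 : ℝ), ∀ z ∈ K,
      dist (S 2 z) (rescaledCorrelator (criticalCorr 3) ρ 2 δ z) < 1 :=
    Metric.tendstoUniformlyOn_iff.1 hU 1 one_pos
  obtain ⟨δ₁, hδ₁⟩ := h1.exists
  refine ⟨ρ δ₁ ^ 2 + 2, h1.mono fun δ hδ z hz => ?_⟩
  have hb : rescaledCorrelator (criticalCorr 3) ρ 2 δ₁ z ≤ ρ δ₁ ^ 2 := by
    rw [rescaledCorrelator_apply]
    calc ρ δ₁ ^ 2 * criticalCorr 3 2 (fun i => latticeApprox δ₁ (z i))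
        ≤ ρ δ₁ ^ 2 * 1 := mul_le_mul_of_nonneg_left
          ((le_abs_self _).trans (abs_criticalCorr_le_one le_rfl _ _)) (sq_nonneg _)
      _ = ρ δ₁ ^ 2 := mul_one _
  have e1 := abs_sub_lt_iff.1 (Real.dist_eq _ _ ▸ hδ₁ z hz)
  have e2 := abs_sub_lt_iff.1 (Real.dist_eq _ _ ▸ hδ z hz)
  have : rescaledCorrelator (criticalCorr 3) ρ 2 δ z =
      ρ δ ^ 2 * criticalCorr 3 2 (fun k => latticeApprox δ (z k)) := rfl
  linarith [e1.1, e1.2, e2.1, e2.2]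

/-- Uniform boundedness of the rescaled two-point function on a closed shell `{ε ≤ ‖y‖ ≤ M}`
(`ε > 0`), for all small `δ > 0`, from the arity-`2` limit alone. [folklore] -/
theorem exists_eventually_rescaled_twoPoint_le₂
    (hlim2 : TendstoLocallyUniformlyOn (rescaledCorrelator (criticalCorr 3) ρ 2) (S 2) (𝓝[>] (0:ℝ))
      (NonCoincident 3 2))
    {ε M : ℝ} (hε : 0 < ε) :
    ∃ C : ℝ, 0 ≤ C ∧ ∀ᶠ δ in 𝓝[>] (0 : ℝ), ∀ y : EuclideanSpace ℝ (Fin 3), ε ≤ ‖y‖ → ‖y‖ ≤ M →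
      ρ δ ^ 2 * criticalTwoPoint 3 (latticeApprox δ y) ≤ C := by
  set Q : Set (EuclideanSpace ℝ (Fin 3)) := {y | ε ≤ ‖y‖ ∧ ‖y‖ ≤ M} with hQ
  have hQc : IsCompact Q := by
    refine Metric.isCompact_of_isClosed_isBounded ?_ ?_
    · exact (isClosed_le continuous_const continuous_norm).inter
        (isClosed_le continuous_norm continuous_const)
    · refine (isBounded_closedBall (x := (0 : EuclideanSpace ℝ (Fin 3))) (r := M)).subset ?_
      intro y hy
      rw [mem_closedBall, dist_zero_right]
      exact hy.2
  set K : Set (Fin 2 → EuclideanSpace ℝ (Fin 3)) :=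
    (fun y : EuclideanSpace ℝ (Fin 3) => (![0, y] : Fin 2 → EuclideanSpace ℝ (Fin 3))) '' Q with hK
  have hKc : IsCompact K := hQc.image continuous_zeroPair
  have hKs : K ⊆ NonCoincident 3 2 := by
    rintro _ ⟨y, hy, rfl⟩
    refine zero_pair_mem_nonCoincident fun h0 => ?_
    have hy' : ε ≤ ‖y‖ := hy.1
    rw [h0, norm_zero] at hy'
    linarith
  obtain ⟨C, hC⟩ := exists_eventually_rescaled_two_le₂ hlim2 hKc hKs
  refine ⟨max C 0, le_max_right _ _, hC.mono fun δ hδ y hy1 hy2 => ?_⟩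
  have h := hδ _ ⟨y, ⟨hy1, hy2⟩, rfl⟩
  rw [latticeApprox_comp_two] at h
  simp only [Matrix.cons_val_zero, Matrix.cons_val_one, Matrix.cons_val_fin_one, latticeApprox_zero,
    criticalCorr_two] at h
  exact h.trans (le_max_left _ _)

/-! ### Bulk convergence of rescaled lattice sums from the pair limit -/

/-- **Bulk convergence of rescaled lattice sums, from the pair limit.** If the renormalised critical
pair correlator converges locally uniformly off the diagonal to `S 2`, `K(y) = S₂(0,y)`, and
`Ψ : ℝ³ → ℝ` is bounded, continuous almost everywhere, and vanishes on `{‖y‖ < ε}` (`ε > 0`) and on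
`{‖y‖ > M}`, then `δ³ ρ(δ)² Σ_{x ∈ ℤ³} Ψ(δx) ⟨σ₀σ_x⟩_{β_c} → ∫ Ψ K` as `δ → 0⁺` (the proof of
`tendsto_scaled_latticeSum`: the lattice sum is the integral of a step function converging pointwise
off a null set and dominated on the compact shell `{ε/2 ≤ ‖y‖ ≤ M+1}`).
[cite: Folland1999, Thm. 2.24 (dominated convergence)] -/
theorem tendsto_scaled_latticeSum₂
    (hlim2 : TendstoLocallyUniformlyOn (rescaledCorrelator (criticalCorr 3) ρ 2) (S 2) (𝓝[>] (0:ℝ))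
      (NonCoincident 3 2))
    {Ψ : EuclideanSpace ℝ (Fin 3) → ℝ} {B ε M : ℝ} (hB : ∀ y, |Ψ y| ≤ B) (hε : 0 < ε)
    (hΨε : ∀ y, ‖y‖ < ε → Ψ y = 0) (hΨM : ∀ y, M < ‖y‖ → Ψ y = 0)
    (hcont : ∀ᵐ y ∂(volume : Measure (EuclideanSpace ℝ (Fin 3))), ContinuousAt Ψ y) :
    Tendsto (fun δ : ℝ => δ ^ 3 * ρ δ ^ 2 *
        ∑' x : Site 3, Ψ (δ • siteVec x) * criticalTwoPoint 3 x)
      (𝓝[>] (0:ℝ)) (𝓝 (∫ y, Ψ y * S 2 ![0, y])) := by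
  -- the step functions
  set F : ℝ → EuclideanSpace ℝ (Fin 3) → ℝ := fun δ y =>
    Ψ (δ • siteVec (latticeApprox δ y)) * (ρ δ ^ 2 * criticalTwoPoint 3 (latticeApprox δ y)) with hF
  have hB0 : 0 ≤ B := (abs_nonneg _).trans (hB 0)
  -- Step 1: the lattice sum is the integral of the step function
  have heq : (fun δ : ℝ => ∫ y, F δ y) =ᶠ[𝓝[>] (0:ℝ)] fun δ => δ ^ 3 * ρ δ ^ 2 *
      ∑' x : Site 3, Ψ (δ • siteVec x) * criticalTwoPoint 3 x := by
    filter_upwards [self_mem_nhdsWithin] with δ hδ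
    rw [show δ ^ 3 * ρ δ ^ 2 * ∑' x : Site 3, Ψ (δ • siteVec x) * criticalTwoPoint 3 x =
      ρ δ ^ 2 * (δ ^ 3 * ∑' x : Site 3, Ψ (δ • siteVec x) * criticalTwoPoint 3 x) by ring,
      cube_mul_tsum_eq_integral (mem_Ioi.1 hδ) hΨM, ← integral_const_mul]
    refine integral_congr_ae (Eventually.of_forall fun y => ?_)
    simp only [hF]
    ring
  -- Step 2: the uniform bound on the shell `ε/2 ≤ ‖y‖ ≤ M + 1`
  obtain ⟨C, hC0, hC⟩ := exists_eventually_rescaled_twoPoint_le₂ hlim2 (ε := ε / 2) (M := M + 1)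
    (half_pos hε)
  have hsmall : ∀ᶠ δ in 𝓝[>] (0:ℝ), δ < min (ε / 4) (1 / 2) :=
    (eventually_lt_nhds (by positivity)).filter_mono nhdsWithin_le_nhds
  set bound : EuclideanSpace ℝ (Fin 3) → ℝ :=
    (closedBall (0 : EuclideanSpace ℝ (Fin 3)) (M + 1)).indicator fun _ => B * C with hbound
  have h_bound : ∀ᶠ δ in 𝓝[>] (0:ℝ), ∀ᵐ y ∂(volume : Measure (EuclideanSpace ℝ (Fin 3))),
      ‖F δ y‖ ≤ bound y := by
    filter_upwards [hC, hsmall, self_mem_nhdsWithin] with δ hCδ hδs hδpos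
    refine Eventually.of_forall fun y => ?_
    have hδ : 0 < δ := hδpos
    have hδε : δ < ε / 4 := hδs.trans_le (min_le_left _ _)
    have hδ1 : δ < 1 / 2 := hδs.trans_le (min_le_right _ _)
    set p := δ • siteVec (latticeApprox δ y) with hp
    by_cases hΨp : Ψ p = 0
    · have : F δ y = 0 := by simp only [hF, ← hp, hΨp, zero_mul]
      rw [this, norm_zero, hbound]
      exact Set.indicator_nonneg (fun _ _ => mul_nonneg hB0 hC0) _
    · have hpε : ε ≤ ‖p‖ := not_lt.1 fun h => hΨp (hΨε p h)
      have hpM : ‖p‖ ≤ M := not_lt.1 fun h => hΨp (hΨM p h)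
      have hdist : ‖p - y‖ ≤ 2 * δ := norm_smul_siteVec_latticeApprox_sub_le hδ y
      have hy1 : ε / 2 ≤ ‖y‖ := by
        have := norm_sub_norm_le p y
        linarith
      have hy2 : ‖y‖ ≤ M + 1 := by
        have := norm_sub_norm_le y p
        rw [norm_sub_rev] at this
        linarith
      have hG := hCδ y hy1 hy2
      have hG0 : 0 ≤ ρ δ ^ 2 * criticalTwoPoint 3 (latticeApprox δ y) :=
        mul_nonneg (sq_nonneg _) (criticalTwoPoint_nonneg' _)
      have hmem : y ∈ closedBall (0 : EuclideanSpace ℝ (Fin 3)) (M + 1) := by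
        rw [mem_closedBall, dist_zero_right]; exact hy2
      rw [hbound, indicator_of_mem hmem, hF]
      simp only [← hp]
      rw [norm_mul, Real.norm_eq_abs, Real.norm_eq_abs, abs_of_nonneg hG0]
      exact mul_le_mul (hB p) hG (hG0) hB0
  -- Step 3: measurability and integrability of the bound
  have h_meas : ∀ᶠ δ in 𝓝[>] (0:ℝ),
      AEStronglyMeasurable (F δ) (volume : Measure (EuclideanSpace ℝ (Fin 3))) := by
    refine Eventually.of_forall fun δ => ?_
    have hg : Measurable fun x : Site 3 =>
        Ψ (δ • siteVec x) * (ρ δ ^ 2 * criticalTwoPoint 3 x) := measurable_of_countable _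
    exact (hg.comp (measurable_latticeApprox δ)).aestronglyMeasurable
  have h_int : Integrable bound (volume : Measure (EuclideanSpace ℝ (Fin 3))) := by
    rw [hbound, integrable_indicator_iff measurableSet_closedBall]
    exact integrableOn_const (measure_closedBall_lt_top.ne)
  -- Step 4: pointwise convergence off the null set `{0} ∪ {discontinuities of Ψ}`
  have h_ne : ∀ᵐ y ∂(volume : Measure (EuclideanSpace ℝ (Fin 3))),
      y ≠ (0 : EuclideanSpace ℝ (Fin 3)) := by
    rw [ae_iff]
    simp
  have h_lim : ∀ᵐ y ∂(volume : Measure (EuclideanSpace ℝ (Fin 3))),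
      Tendsto (fun δ => F δ y) (𝓝[>] (0:ℝ)) (𝓝 (Ψ y * S 2 ![0, y])) := by
    filter_upwards [hcont, h_ne] with y hcy hy
    have h1 : Tendsto (fun δ : ℝ => Ψ (δ • siteVec (latticeApprox δ y))) (𝓝[>] (0:ℝ)) (𝓝 (Ψ y)) :=
      hcy.tendsto.comp (tendsto_smul_siteVec_latticeApprox y)
    exact h1.mul (tendsto_rescaled_twoPoint₂ hlim2 hy)
  have hmain := tendsto_integral_filter_of_dominated_convergence bound h_meas h_bound h_int h_lim
  exact hmain.congr' heq

/-! ### Shell sums and the shell ratio from the pair limit -/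

/-- **Convergence of the rescaled lattice shell sums** from the pair limit: for `0 < a < b`,
`δ³ρ(δ)² Σ_{a < ‖δx‖ ≤ b} ⟨σ₀σ_x⟩_{β_c} → ∫_{a<‖y‖≤b} K`. [folklore] -/
theorem tendsto_shellSum₂
    (hlim2 : TendstoLocallyUniformlyOn (rescaledCorrelator (criticalCorr 3) ρ 2) (S 2) (𝓝[>] (0:ℝ))
      (NonCoincident 3 2))
    {a b : ℝ} (ha : 0 < a) :
    Tendsto (fun δ : ℝ => δ ^ 3 * ρ δ ^ 2 *
        ∑' x : Site 3, shell[a, b] (δ • siteVec x) * criticalTwoPoint 3 x)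
      (𝓝[>] (0:ℝ)) (𝓝 (∫ y, shell[a, b] y * S 2 ![0, y])) :=
  tendsto_scaled_latticeSum₂ hlim2 (B := 1) (abs_shell_le a b) ha
    (fun _ hy => shell_eq_zero_of_lt hy) (fun _ hy => shell_eq_zero_of_gt hy)
    (ae_continuousAt_shell a b)

/-- **The shell ratio from the pair limit.** If `K = S₂(0,·)` is continuous and positive off `0` and
`S` is scale covariant with `Δ ≤ 1`, then for all small `δ > 0` the inner dyadic lattice shell
carries at most `2/3` of the mass of the outer one:
`Σ_{1/4<‖δx‖≤1/2} ⟨σ₀σ_x⟩ ≤ (2/3) Σ_{1/2<‖δx‖≤1} ⟨σ₀σ_x⟩` (the limiting ratio is `2^{2Δ-3} ≤ 1/2`).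
[folklore] -/
theorem eventually_shellSum_ratio₂ (hρ : ∀ δ ∈ Set.Ioc (0:ℝ) 1, 0 < ρ δ)
    (hlim2 : TendstoLocallyUniformlyOn (rescaledCorrelator (criticalCorr 3) ρ 2) (S 2) (𝓝[>] (0:ℝ))
      (NonCoincident 3 2))
    (hsc : IsScaleCovariant Δ S)
    (hΔ : Δ ≤ 1) (hcont : ContinuousOn (fun y : EuclideanSpace ℝ (Fin 3) => S 2 ![0, y]) {0}ᶜ)
    (hpos : ∀ y : EuclideanSpace ℝ (Fin 3), y ≠ 0 → 0 < S 2 ![0, y]) :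
    ∀ᶠ δ in 𝓝[>] (0:ℝ),
      ∑' x : Site 3, shell[1 / 4, 1 / 2] (δ • siteVec x) * criticalTwoPoint 3 x ≤
        2 / 3 * ∑' x : Site 3, shell[1 / 2, 1] (δ • siteVec x) * criticalTwoPoint 3 x := by
  set J : ℝ := ∫ y, shell[1 / 2, 1] y * S 2 ![0, y] with hJ
  set J' : ℝ := ∫ y, shell[1 / 4, 1 / 2] y * S 2 ![0, y] with hJ'
  have hJpos : 0 < J := integral_shell_pos hcont hpos
  have hJ'le : J' ≤ J / 2 := by
    rw [hJ', integral_shell_half hsc, ← hJ]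
    have h4 : (2⁻¹ : ℝ) ^ (-(2 * Δ)) ≤ 4 := by
      rw [Real.inv_rpow (by norm_num), ← Real.rpow_neg (by norm_num), neg_neg]
      calc (2:ℝ) ^ (2 * Δ) ≤ (2:ℝ) ^ ((2:ℕ):ℝ) :=
            Real.rpow_le_rpow_of_exponent_le (by norm_num) (by push_cast; linarith)
        _ = 4 := by rw [Real.rpow_natCast]; norm_num
    nlinarith
  have hu := tendsto_shellSum₂ hlim2 (a := 1 / 4) (b := 1 / 2) (by norm_num)
  have hv := tendsto_shellSum₂ hlim2 (a := 1 / 2) (b := 1) (by norm_num)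
  rw [← hJ'] at hu
  rw [← hJ] at hv
  have hu' : ∀ᶠ δ in 𝓝[>] (0:ℝ), δ ^ 3 * ρ δ ^ 2 *
      ∑' x : Site 3, shell[1 / 4, 1 / 2] (δ • siteVec x) * criticalTwoPoint 3 x < 7 * J / 12 :=
    (tendsto_order.1 hu).2 _ (by linarith)
  have hv' : ∀ᶠ δ in 𝓝[>] (0:ℝ), 7 * J / 8 < δ ^ 3 * ρ δ ^ 2 *
      ∑' x : Site 3, shell[1 / 2, 1] (δ • siteVec x) * criticalTwoPoint 3 x :=
    (tendsto_order.1 hv).1 _ (by linarith)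
  have hδ1 : ∀ᶠ δ in 𝓝[>] (0:ℝ), δ < 1 :=
    (eventually_lt_nhds one_pos).filter_mono nhdsWithin_le_nhds
  filter_upwards [hu', hv', hδ1, self_mem_nhdsWithin] with δ h1 h2 h3 hδpos
  have hδ : 0 < δ := hδpos
  have hc : 0 < δ ^ 3 * ρ δ ^ 2 := mul_pos (pow_pos hδ 3) (pow_pos (hρ δ ⟨hδ, h3.le⟩) 2)
  refine le_of_mul_le_mul_left ?_ hc
  rw [← mul_assoc, mul_comm (δ ^ 3 * ρ δ ^ 2) (2 / 3), mul_assoc]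
  linarith

/-- The shell-ratio threshold in the scale variable `L = δ⁻¹`, from the pair limit: beyond some
`L₀ ≥ 1`, `Σ_{L/4<‖x‖≤L/2} ⟨σ₀σ_x⟩ ≤ (2/3) Σ_{L/2<‖x‖≤L} ⟨σ₀σ_x⟩`. [folklore] -/
theorem exists_ratio_scale₂ (hρ : ∀ δ ∈ Set.Ioc (0:ℝ) 1, 0 < ρ δ)
    (hlim2 : TendstoLocallyUniformlyOn (rescaledCorrelator (criticalCorr 3) ρ 2) (S 2) (𝓝[>] (0:ℝ))
      (NonCoincident 3 2))
    (hsc : IsScaleCovariant Δ S)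
    (hΔ : Δ ≤ 1) (hcont : ContinuousOn (fun y : EuclideanSpace ℝ (Fin 3) => S 2 ![0, y]) {0}ᶜ)
    (hpos : ∀ y : EuclideanSpace ℝ (Fin 3), y ≠ 0 → 0 < S 2 ![0, y]) :
    ∃ L₀ : ℝ, 1 ≤ L₀ ∧ ∀ L, L₀ ≤ L →
      ∑' x : Site 3, shell[1 / 2, 1] ((L / 2)⁻¹ • siteVec x) * criticalTwoPoint 3 x ≤
        2 / 3 * ∑' x : Site 3, shell[1 / 2, 1] (L⁻¹ • siteVec x) * criticalTwoPoint 3 x := by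
  have hev := tendsto_inv_atTop_nhdsGT_zero.eventually
    (eventually_shellSum_ratio₂ hρ hlim2 hsc hΔ hcont hpos)
  obtain ⟨L₁, hL₁⟩ := eventually_atTop.1 hev
  refine ⟨max L₁ 1, le_max_right _ _, fun L hL => ?_⟩
  have h := hL₁ L ((le_max_left _ _).trans hL)
  have hrw : ∀ x : Site 3,
      shell[1 / 2, 1] ((L / 2)⁻¹ • siteVec x) = shell[1 / 4, 1 / 2] (L⁻¹ • siteVec x) := by
    intro x
    rw [show (L / 2)⁻¹ • siteVec x = (2:ℝ) • (L⁻¹ • siteVec x) by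
      rw [smul_smul, inv_div, div_eq_mul_inv], shell_two_smul]
    norm_num
  simp only [hrw]
  exact h

/-! ### The renormalisation from the pair limit: `δ³ ρ(δ)² → 0` -/

/-- **`δ³ ρ(δ)² → 0` as `δ → 0⁺`**, from the pair limit: at the site `[e₀/δ] = ⌊1/δ⌋e₀` the lower
bound `⟨σ₀σ_x⟩_{β_c} ≥ c‖x‖_∞⁻²` (Simon–Lieb, `criticalTwoPoint_bounds_holds`) gives
`ρ(δ)² c δ² ≤ ρ(δ)² ⟨σ₀σ_{[e₀/δ]}⟩ → K(e₀)`, so `δ³ρ(δ)² = O(δ)`.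
[cite: DuminilCopin2019, Thm. 4.8, §4.4] -/
theorem tendsto_cube_mul_rho_sq₂
    (hlim2 : TendstoLocallyUniformlyOn (rescaledCorrelator (criticalCorr 3) ρ 2) (S 2) (𝓝[>] (0:ℝ))
      (NonCoincident 3 2)) :
    Tendsto (fun δ : ℝ => δ ^ 3 * ρ δ ^ 2) (𝓝[>] (0:ℝ)) (𝓝 0) := by
  obtain ⟨c, C, hc, hbd⟩ := criticalTwoPoint_bounds_holds (d := 3) le_rfl
  set e : EuclideanSpace ℝ (Fin 3) := EuclideanSpace.single (0 : Fin 3) (1:ℝ) with he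
  have he0 : e ≠ 0 := by
    intro h
    have := congrArg (fun v : EuclideanSpace ℝ (Fin 3) => v 0) h
    simp [he] at this
  set κ : ℝ := S 2 ![0, e] + 1 with hκ
  have hconv := tendsto_rescaled_twoPoint₂ hlim2 he0
  have hev1 : ∀ᶠ δ in 𝓝[>] (0:ℝ), ρ δ ^ 2 * criticalTwoPoint 3 (latticeApprox δ e) < κ :=
    (tendsto_order.1 hconv).2 _ (by rw [hκ]; linarith)
  have hδ1 : ∀ᶠ δ in 𝓝[>] (0:ℝ), δ < 1 :=
    (eventually_lt_nhds one_pos).filter_mono nhdsWithin_le_nhds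
  have hup : ∀ᶠ δ in 𝓝[>] (0:ℝ), δ ^ 3 * ρ δ ^ 2 ≤ κ / c * δ := by
    filter_upwards [hev1, hδ1, self_mem_nhdsWithin] with δ h1 h2 hδpos
    have hδ : 0 < δ := hδpos
    set b : Site 3 := latticeApprox δ e with hb
    have hb' : b = Pi.single (0 : Fin 3) ⌊1 / δ⌋ := by rw [hb, he, latticeApprox_single]
    have hfloor1 : (1:ℤ) ≤ ⌊1 / δ⌋ := by
      rw [Int.le_floor, Int.cast_one, le_div_iff₀ hδ, one_mul]; exact h2.le
    have hfloorpos : (0:ℝ) < (⌊1 / δ⌋ : ℝ) := by exact_mod_cast hfloor1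
    have hnorm : ‖b‖ = (⌊1 / δ⌋ : ℝ) := by
      rw [hb', norm_single_axis, abs_of_pos hfloorpos]
    have hb0 : b ≠ 0 := by
      intro h0
      rw [h0, norm_zero] at hnorm
      linarith
    have hnorm_le : ‖b‖ ≤ 1 / δ := by rw [hnorm]; exact Int.floor_le _
    have hnorm_pos : 0 < ‖b‖ := by rw [hnorm]; exact hfloorpos
    -- the lower bound at `b`
    have hlow := (hbd b hb0).1
    have hrpow : (1 / δ) ^ (-((3:ℝ) - 1)) ≤ ‖b‖ ^ (-((3:ℝ) - 1)) :=
      Real.rpow_le_rpow_of_nonpos hnorm_pos hnorm_le (by norm_num)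
    have hδ2 : (1 / δ) ^ (-((3:ℝ) - 1)) = δ ^ 2 := by
      rw [show (-((3:ℝ) - 1)) = -(2:ℝ) by norm_num, Real.rpow_neg (by positivity), one_div,
        Real.inv_rpow hδ.le, inv_inv, show (2:ℝ) = ((2:ℕ):ℝ) by norm_num, Real.rpow_natCast]
    have hG : c * δ ^ 2 ≤ criticalTwoPoint 3 b := by
      calc c * δ ^ 2 = c * (1 / δ) ^ (-((3:ℝ) - 1)) := by rw [hδ2]
        _ ≤ c * ‖b‖ ^ (-((3:ℝ) - 1)) := mul_le_mul_of_nonneg_left hrpow hc.le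
        _ ≤ criticalTwoPoint 3 b := by exact_mod_cast hlow
    have hρ2 : 0 ≤ ρ δ ^ 2 := sq_nonneg _
    have hkey : ρ δ ^ 2 * (c * δ ^ 2) < κ := (mul_le_mul_of_nonneg_left hG hρ2).trans_lt h1
    rw [div_mul_eq_mul_div, le_div_iff₀ hc]
    nlinarith
  have hlow : ∀ᶠ δ in 𝓝[>] (0:ℝ), 0 ≤ δ ^ 3 * ρ δ ^ 2 := by
    filter_upwards [self_mem_nhdsWithin] with δ hδ
    exact mul_nonneg (pow_nonneg (le_of_lt hδ) 3) (sq_nonneg _)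
  have hlin : Tendsto (fun δ : ℝ => κ / c * δ) (𝓝[>] (0:ℝ)) (𝓝 0) := by
    have h : Tendsto (fun δ : ℝ => κ / c * δ) (𝓝 (0:ℝ)) (𝓝 (κ / c * 0)) :=
      tendsto_id.const_mul _
    rw [mul_zero] at h
    exact h.mono_left nhdsWithin_le_nhds
  exact tendsto_of_tendsto_of_tendsto_of_le_of_le' tendsto_const_nhds hlin hlow hup

end Summit.CriticalPhenomena.Ising3DConformalLimit.HarmonicMomentsIsotropyTwoPoint

end
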